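import Summits.CriticalPhenomena.PercolationContinuityZ3.Theorems.PercNearOneGluingNoHeavyLowerTailSahiCombJunta
import Summits.CriticalPhenomena.PercolationContinuityZ3.Theorems.PercNearOneGluingNoHeavyLowerTailSahiCombSubstitution
import Summits.CriticalPhenomena.PercolationContinuityZ3.Theorems.PercNearOneGluingNoHeavyLowerTailThreePartitionCubeSix

/-!
# Six letters IN EVERY DIMENSION — the dimension-free strata of (M⁺-3) that read the six-letter certificate
# (junta-intersection with six coordinates; monotone patterns of six independent block events)

Support file (cell `prim-sahi`, seat `prim-sahi-typer` gen 36; `--supports stmt-CriticalPhenomena-4575`; proposed `--computational`: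
every theorem here has in its closure the declared `native_decide` axioms of the six-letter certificate
`SahiC3CombCube.combPos_sahiE_three_of_card_le_six` (`…ThreePartitionCubeSix`, gen 35: the 27 chunk facts `…ThreePartitionCubeChunk*`,
`…ThreePartitionCubeFacts6`, and the `≤ 5`-letter chain of `…SahiC3CombCubeFive`); nothing else non-standard, no `sorry`, no definitions).

The two dimension-free transfer principles of the comb (tensor-Bernstein) calculus in the tree take "(M⁺-3) on a small cube" as their
only hypothesis:
* P3's JUNTA-INTERSECTION theorem `SahiCombJunta.combPos_sahiE_three_of_inter_determinedBy` (`…SahiCombJunta`): (M⁺-3) on the cube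
  `↥W` ⟹, in every dimension, (M⁺-3) for `(U, A, B)` with `U` an ARBITRARY increasing event and `A ∩ B` determined by the coordinates in `W`;
* P3's BLOCK-SUBSTITUTION theorem `SahiCombSubstitution.combPos_sahiE_three_subst` (`…SahiCombSubstitution`): (M⁺-3) for three increasing
  patterns on the cube `2^{Fin r}` ⟹, in every dimension, (M⁺-3) for the events obtained by substituting `r` increasing events with pairwise
  disjoint supports into the patterns.
With four letters (`…SahiCombJuntaFour`, `…SahiCombSubstitutionFour`) and five letters (`…SahiCombJuntaFive`) in the tree, the six-letter
certificate of gen 35 now gives the six-coordinate / six-block classes: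

* `SahiCombJunta.cubeCombPos3_of_card_le_six` — (M⁺-3) on every cube `↥W` with `|W| ≤ 6`;
* **`SahiCombJunta.combPos_sahiE_three_of_inter_determinedBy_card_le_six`** — `A ∩ B` determined by at most SIX coordinates ⟹ (M⁺-3) for
  `(U, A, B)`, every increasing `U`, every finite ground set; law level (`sahiE_three_ind_nonneg_…`: Kahn's Conjecture 5 / Sahi's `C₃` for
  every product measure on this class) and (★★) (`threePartNT_nonneg_…`, every twist); `…_of_determinedBy_all_card_le_six` (all three events
  read a common set of `≤ 6` coordinates);
* **`SahiCombSubstitution.combPos_sahiE_three_subst_le_six`** — monotone Boolean combinations of at most SIX increasing events with pairwise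
  disjoint supports satisfy (M⁺-3) in every dimension; law level and (★★).
HONEST LABEL: computational (closure as stated); the six-letter CASES only — Kahn's Conjecture 5 / Sahi's `C₃` remain OPEN in general and
nothing here bears on them beyond these classes. [this work]
-/

noncomputable section

open scoped Classical

namespace Summit.CriticalPhenomena.PercolationContinuityZ3.Theorems

namespace SahiCombJunta

open Finset Function
open Literature.Combinatorics.Sahi2008
open Literature.Probability.Percolation (DeterminedBy)
open Literature.Probability.Percolation.DecisionTree (ind)
open SahiComb

variable {ι : Type} [Fintype ι]

/-- (M⁺-3) on the cube `↥W` for `|W| ≤ 6` (the six-letter pair-saturation certificate read at comb level). [this work] [computational] -/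
theorem cubeCombPos3_of_card_le_six (W : Set ι) (hW : Fintype.card ↥W ≤ 6) : CubeCombPos3 W :=
  fun _ _ _ hX hY hZ => SahiC3CombCube.combPos_sahiE_three_of_card_le_six hW hX hY hZ

/-- **Junta-intersection with six coordinates**: if `A ∩ B` is determined by a set `W` of at most six coordinates, then (M⁺-3) holds for
`(U, A, B)` for every increasing `U`, in every dimension. [this work] [computational] -/
theorem combPos_sahiE_three_of_inter_determinedBy_card_le_six (W : Finset ι) (hW : W.card ≤ 6) {U A B : Set (Set ι)}
    (hU : IsUpperSet U) (hA : IsUpperSet A) (hB : IsUpperSet B) (hK : DeterminedBy (A ∩ B) (↑W : Set ι)) :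
    CombPos (fun _ : ι => 3) (fun p => sahiE (bernoulliWeight p) 3 ![ind U, ind A, ind B]) :=
  combPos_sahiE_three_of_inter_determinedBy W (cubeCombPos3_of_card_le_six _ (by
    rw [← Set.toFinset_card, Finset.toFinset_coe]
    exact hW)) hU hA hB hK

/-- Law level: `E₃(μ_p; U, A, B) ≥ 0` whenever `A ∩ B` depends on at most six coordinates (every product measure, every dimension) — Kahn's
Conjecture 5 on this class. [this work] [computational] -/
theorem sahiE_three_ind_nonneg_of_inter_determinedBy_card_le_six (p : ι → unitInterval) (W : Finset ι) (hW : W.card ≤ 6)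
    {U A B : Set (Set ι)} (hU : IsUpperSet U) (hA : IsUpperSet A) (hB : IsUpperSet B) (hK : DeterminedBy (A ∩ B) (↑W : Set ι)) :
    0 ≤ sahiE (bernoulliWeight p) 3 ![ind U, ind A, ind B] :=
  (combPos_sahiE_three_of_inter_determinedBy_card_le_six W hW hU hA hB hK).nonneg p

/-- (★★) on the six-coordinate junta class: `threePartNT τ U A B ≥ 0` for every twist. [this work] [computational] -/
theorem threePartNT_nonneg_of_inter_determinedBy_card_le_six (τ : Set ι) (W : Finset ι) (hW : W.card ≤ 6) {U A B : Set (Set ι)}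
    (hU : IsUpperSet U) (hA : IsUpperSet A) (hB : IsUpperSet B) (hK : DeterminedBy (A ∩ B) (↑W : Set ι)) :
    0 ≤ ThreePartition.threePartNT τ U A B :=
  ThreePartition.threePartNT_nonneg_of_combPos τ (combPos_sahiE_three_of_inter_determinedBy_card_le_six W hW hU hA hB hK)

/-- All three events determined by a common set of at most six coordinates: (M⁺-3) in every dimension (sub-cube transport
`combPos_sahiE_three_of_determinedBy_all`). [this work] [computational] -/
theorem combPos_sahiE_three_of_determinedBy_all_card_le_six (W : Finset ι) (hW : W.card ≤ 6) {X Y Z : Set (Set ι)}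
    (hX : IsUpperSet X) (hY : IsUpperSet Y) (hZ : IsUpperSet Z) (hXd : DeterminedBy X (↑W : Set ι)) (hYd : DeterminedBy Y (↑W : Set ι))
    (hZd : DeterminedBy Z (↑W : Set ι)) :
    CombPos (fun _ : ι => 3) (fun p => sahiE (bernoulliWeight p) 3 ![ind X, ind Y, ind Z]) :=
  combPos_sahiE_three_of_determinedBy_all (↑W : Set ι) (cubeCombPos3_of_card_le_six _ (by
    rw [← Set.toFinset_card, Finset.toFinset_coe]
    exact hW)) hX hY hZ hXd hYd hZd

/-- Law level for the common-junta class: `E₃(μ_p; X, Y, Z) ≥ 0` for three increasing events reading at most six common coordinates, every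
product measure, every dimension. [this work] [computational] -/
theorem sahiE_three_ind_nonneg_of_determinedBy_all_card_le_six (p : ι → unitInterval) (W : Finset ι) (hW : W.card ≤ 6)
    {X Y Z : Set (Set ι)} (hX : IsUpperSet X) (hY : IsUpperSet Y) (hZ : IsUpperSet Z) (hXd : DeterminedBy X (↑W : Set ι))
    (hYd : DeterminedBy Y (↑W : Set ι)) (hZd : DeterminedBy Z (↑W : Set ι)) :
    0 ≤ sahiE (bernoulliWeight p) 3 ![ind X, ind Y, ind Z] :=
  (combPos_sahiE_three_of_determinedBy_all_card_le_six W hW hX hY hZ hXd hYd hZd).nonneg p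

end SahiCombJunta

namespace SahiCombSubstitution

open Finset Function
open Literature.Combinatorics.Sahi2008
open Literature.Probability.Percolation (DeterminedBy)
open Literature.Probability.Percolation.DecisionTree (ind)
open SahiComb

variable {ι : Type} [Fintype ι] {r : ℕ}

/-- **Block substitution, at most six blocks**: monotone Boolean combinations of `r ≤ 6` increasing events with pairwise disjoint supports
satisfy (M⁺-3) in every dimension (patterns certified on the `6`-cube by `SahiC3CombCube.combPos_sahiE_three_of_card_le_six`).
[this work] [computational] -/
theorem combPos_sahiE_three_subst_le_six (hr : r ≤ 6) (X : Fin r → Set (Set ι)) (S : Fin r → Finset ι)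
    (hS : (Set.univ : Set (Fin r)).PairwiseDisjoint S) (hXd : ∀ j, DeterminedBy (X j) (↑(S j) : Set ι))
    (Φ : Fin 3 → Set (Set (Fin r))) (hΦ : ∀ i, IsUpperSet (Φ i)) :
    CombPos (fun _ : ι => 3) (fun p => sahiE (bernoulliWeight p) 3 (fun i => ind (subst X (Φ i)))) :=
  combPos_sahiE_three_subst X S hS hXd Φ ((ThreePartition.combPos_vec_iff Φ).2
    (SahiC3CombCube.combPos_sahiE_three_of_card_le_six (by simpa using hr) (hΦ 0) (hΦ 1) (hΦ 2)))

/-- Law level: `E₃(μ_p) ≥ 0` for monotone combinations of at most six independent increasing block events, every product measure, every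
dimension. [this work] [computational] -/
theorem sahiE_three_subst_nonneg_le_six (p : ι → unitInterval) (hr : r ≤ 6) (X : Fin r → Set (Set ι)) (S : Fin r → Finset ι)
    (hS : (Set.univ : Set (Fin r)).PairwiseDisjoint S) (hXd : ∀ j, DeterminedBy (X j) (↑(S j) : Set ι))
    (Φ : Fin 3 → Set (Set (Fin r))) (hΦ : ∀ i, IsUpperSet (Φ i)) :
    0 ≤ sahiE (bernoulliWeight p) 3 (fun i => ind (subst X (Φ i))) :=
  (combPos_sahiE_three_subst_le_six hr X S hS hXd Φ hΦ).nonneg p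

/-- (★★) for substituted triples with at most six blocks: `threePartNT τ ≥ 0`, every twist. [this work] [computational] -/
theorem threePartNT_subst_nonneg_le_six (τ : Set ι) (hr : r ≤ 6) (X : Fin r → Set (Set ι)) (S : Fin r → Finset ι)
    (hS : (Set.univ : Set (Fin r)).PairwiseDisjoint S) (hXd : ∀ j, DeterminedBy (X j) (↑(S j) : Set ι))
    (Φ : Fin 3 → Set (Set (Fin r))) (hΦ : ∀ i, IsUpperSet (Φ i)) :
    0 ≤ ThreePartition.threePartNT τ (subst X (Φ 0)) (subst X (Φ 1)) (subst X (Φ 2)) :=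
  ThreePartition.threePartNT_nonneg_of_combPos τ ((ThreePartition.combPos_vec_iff (fun i => subst X (Φ i))).1
    (combPos_sahiE_three_subst_le_six hr X S hS hXd Φ hΦ))

end SahiCombSubstitution

end Summit.CriticalPhenomena.PercolationContinuityZ3.Theorems
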